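import Summits.QuantumFields.YangMills.Theorems.BalabanUVNodesN11Sect3SupplyChainObligationsDefs
import Summits.QuantumFields.YangMills.Theorems.BalabanUVNodesN11FirstStepSupplyLabels

/-!
# DAG node N11 — THE FIRST LINK OF THE WITNESS CHAIN IS THE FIRST STEP: the level-`0` slice of dag-n11-e's `SupplierObligations θ p σ` (token `SupplyChainAt θ p`) READ OFF
# in the witness-free first-step currencies (`FirstStepClausesAt ∕ FirstStepSupplyAtLabels ∕ Sect3SupplyAt θ p 0`), and CONVERSELY the chain's level-`1` witness from them

HEADER — WORK-UNIT METADATA.  Cell `pub-ymgap`, YM-PLAN Track A (HUMAN RULING D-0062 ∕ D-0149 width push), seat `pub-ymgap-dag-n08-w2` (g2; WIDTH SEAT re-pointed by the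
dag-lead desk to N11's §3-supply residue, DEDUP-354∕355; successor trigger (t1) of this seat's g0 HANDOFF = dag-n11-e's (t57∕t58) «at k = 0: n08-w2's `FirstStepSupplyAt`»,
fired by the landing of dag-n11-e g16's `…Sect3SupplyChainObligationsDefs` p595576), route `BalabanUVNodes` rev 25 (v1.7 `CoPH` key), item K1⁷ `StabilityBAtRecordR13SepCoPH` =
stmt-QuantumFields-20542; DEFINITION lane (`--supports 20542 --as helper`), count-neutral.  [III] = [Balaban1988Convergent], [I] = [Balaban1987RG1], [II] = [Balaban1988RG2Cluster].
Over dag-n11-e's `…Sect3SupplyChainDefs ∕ …Sect3SupplyChain ∕ …Sect3SupplyChainObligationsDefs ∕ …SpliceOwnBoundary` (p591185 ∕ p591271 ∕ p595576 ∕ p590537) and this seat's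
`…N11FirstStepSupply ∕ …FirstStepSupplyLabels` (p586913 ∕ p588912 ∕ p591626).

WHY THIS FILE.  dag-n11-e g16 reduced N11 at `(θ, p)` to ONE token `SupplyChainAt θ p = ∃ σ, SupplierObligations θ p σ ∧ NoExpansionObligation θ p σ`, every obligation
keyed to the supplier's OWN chain `chainWitness θ p σ k` and allowed to assume the inductive hypothesis `ChainFormAt θ p σ k`.  AT THE FIRST LINK `k = 0` none of this
reads the chain: `ChainFormAt θ p σ 0` is a theorem (`chainFormAt_zero`), and the obligations at a 𝐓-present expansion pair ((O1′) void, (O2) r11's new-term clauses +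
analyticity at level 1, (O3′) the 𝐓-image identity for `graftAboveB 0 (base (init s′)) (tnew s′)`) do not read the level-`0` witness: 11c's slot `𝐓₁(s′) exp A₁(s′)` reads the
levels `1 … 1` only, where the own-𝐁 graft IS the new source (§1).  So the first link is EXACTLY the first renormalization step — [I] Thm 1 + [II] at def-T's level-1 objects —
in the currency of this seat's g0 files, plus the four 𝐄-clauses: §3 reads it OFF any supplier (necessity), §4 feeds it INTO the chain (sufficiency: `ChainFormTAt θ p σ 0`,
`TLaw₁₃CoPH θ p 0`, and `ρ₁`'s §2 form on the live-selector line — «the chain closes level by level», dag-n11-e's TRIGGERS t57∕t58), §6 the same at the door of record.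

WHAT THIS FILE PROVES (2 `def`∕`structure … : Prop` naming displayed hypotheses + 1 `def` (a supplier built from first-step data); theorems otherwise; 0 `sorry`, standard axioms).
§1 `sect2Slot_graftAboveB_zero` — at length 1 the slot of `graftAboveB 0 t u` IS the slot of `u` (twin of g0's `sect2Slot_graftAbove_zero` for dag-n11-e's own-𝐁 graft).
§2 `def FirstStepClausesAt θ p s u₁ e₁` — THE PER-PAIR MATRIX of `FirstStepSupplyAt` (p586913) for ONE term value and ONE constant at ONE history of length 1: (i) r11's
   `Step.LFNewTerms … 0`, (ii) analyticity of `𝐄^{(1)} ∕ 𝐑^{(1)} ∕ 𝐁^{(1)}`, (iii) `𝐓ρ₀(s) ≡ 0 ∨ 𝐓ρ₀(s) = 𝐓₁(s)[W(s)] exp A₁(s)[u₁, e₁]` a.e. on supp `χ₁(s)`; `firstStepSupplyAt_iff_clauses`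
   (`Iff.rfl`) · ★ `presentChildObligations_zero_iff` — `PresentChildObligations θ p 0 t tnew EkN s ↔ FirstStepClausesAt θ p s (tnew s) (EkN s)` for EVERY level-0 witness `t`.
§3 `structure FirstLinkObligations θ p σ` — the `k = 0` fields univE ∕ newE ∕ present of `SupplierObligations θ p σ` (`0 < K` and `ChainFormAt … 0` discharged, (present) in the
   first-step currency; (loc) is not part of the link) · `newEClausesAt_of_universalE` ((newE) is history-free: one history suffices) ·
   `firstLinkObligations_of_supplierObligations` · ★ `FirstLinkObligations.firstStepSupplyAtLabels` ∕ `.sect3SupplyAt_zero` · ★★ `firstStepSupplyAtLabels_of_supplyChainAt` ∕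
   `sect3SupplyAt_zero_of_supplyChainAt` (`0 ≤ E₀, B₀`) — N11's ONE-TOKEN RESIDUAL CONTAINS THE FIRST STEP.  (NOT derivable: the history-keyed `FirstStepSupplyAt θ p`, which
   also binds the 𝐓-ABSENT expansion pairs — the chain owes nothing there.)
§4 ★ `FirstLinkObligations.chainFormTAt_zero` (`1 ≤ M`, `0 ≤ B₀`, + `NoExpansionClauseFor θ p 0` for the base witness ⇒ `ChainFormTAt θ p σ 0`; dag-n11-e's ★★ at `k = 0`) ·
   `.tLaw₁₃CoPH_zero` · ★ `.chainFormAt_one` ∕ `.sLaw₁₃CoPH_one` (live-selector line: core provisos, selector clause, admissibility, signs, `0 < K`) · `def firstStepSupplier θ p u E₁`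
   (level-0 response `(u, E₁)`, zero above) with `firstLinkObligations_firstStepSupplier_iff` and the σ-free face ★ `sLaw₁₃CoPH_one_of_firstStepClauses`.
§5 ★ `supplyChainAt_iff_of_K_eq_one` — for a ONE-STEP run (`K = 1`) N11's token IS «first-step data ((loc) + the first link) ∧ the level-0 no-expansion clause for the base witness».
§6 ★ `sLaw₁₃CoPH_one_rePinH_doorCured_theta13LiveOfRecord_of_firstLink` ∕ ★★ `…_of_supplyChainAt` — at the re-pinned door of K0a's cured witness of record, `ρ₁`'s §2 form from
   the first link (resp. N11's token) and `0 < K` — NOTHING ELSE (g0's `…_of_firstStepSupplyAtLabels` over §3).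

HONEST FRAMING.  Count-neutral kernel bookkeeping + two `Prop`-valued names for displayed hypotheses + one supplier constructor; `FirstStepClausesAt` at the 𝐓-present pairs IS
[I] Thm 1 + [II] (the first small-field step at def-T's level-1 objects) — NOT proved here for any `θ`, run or history (NODE 00-sized one-carrier instantiation); nothing of
Bałaban asserted; N11 NOT discharged; K1⁷ NOT closed; counts unmoved (typed 28∕28 · discharged 5∕27).  One finite `𝕋⁴_{L^K}` programme at fixed `ε = L^{−K}`; R4 closes only
the conditional finite-𝕋⁴ rung `BalabanLadder.UV` — NOT ℝ⁴, NOT OS, NOT a mass gap, NOT Clay.  No `sorry`, no `axiom`, no `instance`, no `notation`.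
Sources (SHAPE only): [III] Theorem p.245, Thm 1 p.262, Thm 2 p.263, §2 p.262, §3 pp.264–265, (3.1) p.264, (3.5) p.265, (3.24)–(3.25) p.270, §3 p.279, (2.17)–(2.18) p.257,
(2.23)–(2.31) pp.258–260, (2.40)–(2.42) p.261; [I] Thm 1 p.258, (0.24)–(0.27) p.257; [IV] = [Balaban1989LargeFieldI] (0.2)–(0.4) p.176, p.177 (i)–(ii).
-/

noncomputable section

open MeasureTheory
open scoped BigOperators Matrix.Norms.L2Operator

namespace Summit.QuantumFields.YangMills.Theorems.BalabanUVNodesN11SupplyChainFirstLink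

open Literature.MathematicalPhysics.QuantumFieldTheory.Balaban1983to89 T4Continuum Node00 Node00.Tk
open Step B14.Eq227LocalizedTerms
open BalabanUVNodesN11Sect3SupplyDefs (Sect3SupplyAt)
open BalabanUVNodesN11Sect3SupplySpliceOwnBoundary (graftAboveB graftAboveB_E_of_lt graftAboveB_R_of_lt graftAboveB_B_of_le)
open BalabanUVNodesN11FluctTruncationDefs (IsFluctLocal)
open BalabanUVNodesN11Sect3SupplyChain (formT_spliceTermsB_of_rows formAtZS_succ_of_formT_of_liveSel_of_rstep)
open BalabanUVNodesN11Sect3SupplySpliceDefs BalabanUVNodesN11Sect3SupplyChainDefs BalabanUVNodesN11Sect3SupplyChainObligationsDefs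
open BalabanUVNodesN11FirstStepSupply BalabanUVNodesN11FirstStepSupplyLabels
open BalabanUVNodesN11RePinnedParamDefs (rePinH)

/-! ## §1. At length 1 the own-𝐁 graft above level 0 gives the slot of the new source -/

section Graft

variable {F : T4Family} {N : ℕ} [NeZero N]
variable {𝔸 : Type*} [NormedRing 𝔸] [NormedAlgebra ℂ 𝔸] [CompleteSpace 𝔸]
variable {ν : Stage7Numerics} {M : ℕ} {g : ℕ → ℝ} {K : ℕ}
variable (V : Type) [NormedAddCommGroup V] [InnerProductSpace ℝ V] [FiniteDimensional ℝ V] [MeasurableSpace V] [BorelSpace V]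

/-- **AT LENGTH 1 THE SLOT OF THE OWN-𝐁 GRAFT ABOVE LEVEL 0 IS THE SLOT OF THE NEW SOURCE**: `𝐓₁(s) exp A₁(s)[graftAboveB 0 t u, E] = 𝐓₁(s) exp A₁(s)[u, E]` — the graft
has `u`'s `𝐄 ∕ 𝐑` above level `0` and `u`'s `𝐁` from level `0` on, and (2.23) at index `1` reads the levels `1 … 1` only (g0's `sect2Slot_congr_of_agree_pos`).
[cite: Balaban1988Convergent, (2.18) p.257, (2.23)–(2.25) pp.258–259, (2.40) p.261, §3 p.279] -/
theorem sect2Slot_graftAboveB_zero (S : Sect2.Setting 𝔸 (SU N)) (Rz : Sect2.Residual (F.P K) 𝔸) (W : TkWeights F N V K)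
    (s : SeqOfRecord F ν M g K 1) (t u : Sect2.TermValues (F.P K) 𝔸 V M) (E : ℝ) (U : BgMap F N K) :
    sect2Slot F N V K S Rz W s (graftAboveB 0 t u) E U = sect2Slot F N V K S Rz W s u E U :=
  sect2Slot_congr_of_agree_pos V S Rz W s (fun _ hj1 _ X z gc φ => graftAboveB_E_of_lt t u hj1 X z gc φ)
    (fun _ hj1 _ X φ => graftAboveB_R_of_lt t u hj1 X φ) (fun j _ _ X φ a => graftAboveB_B_of_le t u (Nat.zero_le j) X φ a) E U

end Graft

/-! ## §2. The per-pair matrix of the first step; at `k = 0` the 𝐓-present child obligations do not read the old witness -/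

section Clauses

variable {F : T4Family} {N : ℕ} [NeZero N]

/-- **THE FIRST-STEP CLAUSES FOR ONE TERM VALUE `u₁` AND ONE CONSTANT `e₁` AT ONE HISTORY `s = (Ω₁, Λ₁)` OF LENGTH 1** — the per-pair matrix of this seat's
`FirstStepSupplyAt θ p` (p586913): (i) r11's new-term obligations `Step.LFNewTerms … 0` on the tower of record along `s` ((2.27)(i),(iii), the improved bounds of p. 262, the
RG equation at `0`); (ii) analyticity of `𝐄^{(1)}(X, ·, z)`, `𝐑^{(1)}(X, ·)` on `U^c_1(X, α_{0,1}, α_{1,1})` and of `𝐁^{(1)}(X, ·, a)` on `Ũ^c_1(X)`; (iii) the 𝐓-IMAGE IDENTITY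
`𝐓ρ₀(s) ≡ 0 ∨ 𝐓ρ₀(s) = 𝐓₁(s)[W(s)] exp A₁(s)[u₁, e₁]` a.e. on the support of `χ₁(s)` ([III] (3.1) ∕ (3.25) at the first step; [I] Thm 1 with [II] behind it).  NOT claimed for any `θ`.
[cite: Balaban1988Convergent, Thm 2 p.263, (3.1) p.264, (3.25) p.270, §3 p.279, (2.27)–(2.31) pp.259–260, (2.41)–(2.42) p.261, (2.17)–(2.18) p.257; Balaban1987RG1, Thm 1 p.258] -/
def FirstStepClausesAt (θ : Stage13HParams F N) (p : B12.RunParams)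
    (s : SeqOfRecord F θ.ν θ.τ9.M (gOfRecord₁₃ F N θ.toStage13Params p) p.K 1) (u₁ : Sect2.TermValues (F.P p.K) (MatA N) (FluctV N) θ.τ9.M) (e₁ : ℝ) : Prop :=
  -- (i) r11's new-term obligations for the first-step terms on the tower of record along `s`
  Step.LFNewTerms (sect2TowerOfRecord F N (FluctV N) p.K (settingOfRecord₁₃ F N θ.toStage13Params p) (θ.rzAt p s) s u₁)
    (settingOfRecord₁₃ F N θ.toStage13Params p).lf (settingOfRecord₁₃ F N θ.toStage13Params p).βc 0 ∧
  -- (ii) analyticity of `𝐄^{(1)} ∕ 𝐑^{(1)} ∕ 𝐁^{(1)}` at level 1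
  (∀ (X : (Sect2.domSys (F.P p.K) θ.τ9.M 1).Dom) (z : Site (F.P p.K) 1) (g : ℝ), 0 ≤ g → g ≤ (settingOfRecord₁₃ F N θ.toStage13Params p).lf.γ →
    AnalyticOnNhd ℂ (u₁.E 1 X z g)
      ((sect2TowerOfRecord F N (FluctV N) p.K (settingOfRecord₁₃ F N θ.toStage13Params p) (θ.rzAt p s) s u₁).space 1 X
        ((settingOfRecord₁₃ F N θ.toStage13Params p).lf.alpha0 ((settingOfRecord₁₃ F N θ.toStage13Params p).flow.g 1))
        ((settingOfRecord₁₃ F N θ.toStage13Params p).lf.alpha1 ((settingOfRecord₁₃ F N θ.toStage13Params p).flow.g 1)))) ∧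
  (∀ X : (Sect2.domSys (F.P p.K) θ.τ9.M 1).Dom,
    AnalyticOnNhd ℂ (u₁.R 1 X)
      ((sect2TowerOfRecord F N (FluctV N) p.K (settingOfRecord₁₃ F N θ.toStage13Params p) (θ.rzAt p s) s u₁).space 1 X
        ((settingOfRecord₁₃ F N θ.toStage13Params p).lf.alpha0 ((settingOfRecord₁₃ F N θ.toStage13Params p).flow.g 1))
        ((settingOfRecord₁₃ F N θ.toStage13Params p).lf.alpha1 ((settingOfRecord₁₃ F N θ.toStage13Params p).flow.g 1)))) ∧
  (∀ (X : (Sect2.domSys (F.P p.K) θ.τ9.M 1).Dom) (a : SFluct (F.P p.K) (FluctV N)),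
    AnalyticOnNhd ℂ (fun φ => u₁.B 1 X φ a)
      ((sect2TowerOfRecord F N (FluctV N) p.K (settingOfRecord₁₃ F N θ.toStage13Params p) (θ.rzAt p s) s u₁).spaceB 1 X)) ∧
  -- (iii) the 𝐓-image identity at the first step
  (slotsTOfRecord F N θ.ν θ.τ9 (EOfRecord₁₃ F N θ.toStage13Params) (wOfRecord₉ F N θ.toStage9Params) θ.ppSel p
      (gOfRecord₁₃ F N θ.toStage13Params p) 1 s = 0 ∨
    ∀ᵐ V' ∂fieldMeasure (F.P p.K) 1 (SU N),
      chiSeqOfRecord F N θ.ν θ.τ9.M (gOfRecord₁₃ F N θ.toStage13Params p) p.K 1 s V' ≠ 0 →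
        slotsTOfRecord F N θ.ν θ.τ9 (EOfRecord₁₃ F N θ.toStage13Params) (wOfRecord₉ F N θ.toStage9Params) θ.ppSel p
            (gOfRecord₁₃ F N θ.toStage13Params p) 1 s V' =
          sect2Slot F N (FluctV N) p.K (settingOfRecord₁₃ F N θ.toStage13Params p) (θ.rzAt p s) (WtOfRecord₁₃H F N θ p s) s
            u₁ e₁ (UbgOfRecord₁₃CoP F N θ.toStage13Params p 1 s) V')

variable (θ : Stage13HParams F N) (p : B12.RunParams)

/-- `FirstStepSupplyAt θ p` IS «ONE family `u` universal in 𝐄 and constants `E₁` with the first-step clauses at every expansion pair» (`Iff.rfl`).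
[cite: Balaban1988Convergent, §3 p.279, Thm 2 p.263 (bookkeeping)] -/
theorem firstStepSupplyAt_iff_clauses :
    FirstStepSupplyAt θ p ↔
      ∃ (u : SeqOfRecord F θ.ν θ.τ9.M (gOfRecord₁₃ F N θ.toStage13Params p) p.K 1 → Sect2.TermValues (F.P p.K) (MatA N) (FluctV N) θ.τ9.M)
        (E₁ : SeqOfRecord F θ.ν θ.τ9.M (gOfRecord₁₃ F N θ.toStage13Params p) p.K 1 → ℝ),
        Sect2.UniversalE u ∧
        ∀ s : SeqOfRecord F θ.ν θ.τ9.M (gOfRecord₁₃ F N θ.toStage13Params p) p.K 1, s.Ω 1 ≠ ∅ → FirstStepClausesAt θ p s (u s) (E₁ s) :=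
  Iff.rfl

variable {θ p}

/-- ★ **AT `k = 0` THE OBLIGATIONS AT A 𝐓-PRESENT EXPANSION CHILD DO NOT READ THE OLD WITNESS**: for EVERY level-`0` witness `t`, dag-n11-e's
`PresentChildObligations θ p 0 t tnew EkN s` IS the first-step matrix for `(tnew s, EkN s)` at `s` — (O1′) is void (`1 ≤ 0` is false), (O2) is (i)–(ii), and (O3′) for
`graftAboveB 0 (t (init s)) (tnew s)` is (iii) by §1. [cite: Balaban1988Convergent, §3 p.279, (3.24)–(3.25) p.270, (2.23)–(2.25) pp.258–259, Thm 2 p.263] -/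
theorem presentChildObligations_zero_iff
    (t : SeqOfRecord F θ.ν θ.τ9.M (gOfRecord₁₃ F N θ.toStage13Params p) p.K 0 → Sect2.TermValues (F.P p.K) (MatA N) (FluctV N) θ.τ9.M)
    (tnew : SeqOfRecord F θ.ν θ.τ9.M (gOfRecord₁₃ F N θ.toStage13Params p) p.K 1 → Sect2.TermValues (F.P p.K) (MatA N) (FluctV N) θ.τ9.M)
    (EkN : SeqOfRecord F θ.ν θ.τ9.M (gOfRecord₁₃ F N θ.toStage13Params p) p.K 1 → ℝ)
    (s : SeqOfRecord F θ.ν θ.τ9.M (gOfRecord₁₃ F N θ.toStage13Params p) p.K 1) :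
    PresentChildObligations θ p 0 t tnew EkN s ↔ FirstStepClausesAt θ p s (tnew s) (EkN s) := by
  have hgr := sect2Slot_graftAboveB_zero (FluctV N) (settingOfRecord₁₃ F N θ.toStage13Params p) (θ.rzAt p s) (WtOfRecord₁₃H F N θ p s) s (t s.init) (tnew s)
    (EkN s) (UbgOfRecord₁₃CoP F N θ.toStage13Params p 1 s)
  constructor
  · rintro ⟨-, hnew, hanE, hanR, hanB, hcl⟩
    exact ⟨hnew, hanE, hanR, hanB, hcl.imp_right fun hae => hae.mono fun V' hV' hχ => (hV' hχ).trans (congrFun hgr V')⟩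
  · rintro ⟨hnew, hanE, hanR, hanB, hcl⟩
    exact ⟨fun h10 => absurd h10 (by omega), hnew, hanE, hanR, hanB,
      hcl.imp_right fun hae => hae.mono fun V' hV' hχ => (hV' hχ).trans (congrFun hgr V').symm⟩

end Clauses

/-! ## §3. The first link of a supplier's obligations, named, and read off in the first-step currencies (necessity) -/

section FirstLink

variable {F : T4Family} {N : ℕ} [NeZero N]

/-- **THE FIRST LINK OF THE SUPPLIER's OBLIGATIONS** — the `k = 0` fields of dag-n11-e's `SupplierObligations θ p σ` for the supplier's LEVEL-0 RESPONSE
`σ 0 (chainWitness θ p σ 0).1 (chainWitness θ p σ 0).2 = (u, E₁)` to the chain's base witness, with `0 < K` and the inductive hypothesis `ChainFormAt θ p σ 0` (a theorem,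
`chainFormAt_zero`) discharged and (present) written in the first-step currency (§2 ★): (univE) `u` is universal in 𝐄; (newE) the four level-1 𝐄-clauses for `u s` at EVERY
history `s` of length 1; (present) the first-step clauses for `(u s, E₁ s)` at every 𝐓-PRESENT expansion pair.  The (loc) field of `SupplierObligations` (locality in the
fluctuation variables, dag-n11-d's rows) is not part of the link.  A structure of displayed hypotheses — nothing claimed.
[cite: Balaban1988Convergent, Thm 1 p.262, Thm 2 p.263, §3 p.279, (3.1) p.264, (3.25) p.270, (2.25)–(2.28) p.259; Balaban1987RG1, Thm 1 p.258] -/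
structure FirstLinkObligations (θ : Stage13HParams F N) (p : B12.RunParams) (σ : Sect3Supplier θ p) : Prop where
  /-- (univE) the level-0 response is universal in 𝐄. -/
  univE : Sect2.UniversalE (σ 0 (chainWitness θ p σ 0).1 (chainWitness θ p σ 0).2).1
  /-- (newE) the four level-1 𝐄-clauses at every history of length 1. -/
  newE : ∀ s : SeqOfRecord F θ.ν θ.τ9.M (gOfRecord₁₃ F N θ.toStage13Params p) p.K 1,
    NewEClausesAt θ p 0 ((σ 0 (chainWitness θ p σ 0).1 (chainWitness θ p σ 0).2).1 s) s
  /-- (present) the first-step clauses at every 𝐓-present expansion pair. -/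
  present : ∀ s : SeqOfRecord F θ.ν θ.τ9.M (gOfRecord₁₃ F N θ.toStage13Params p) p.K 1, s.Ω 1 ≠ ∅ →
    slotsTOfRecord F N θ.ν θ.τ9 (EOfRecord₁₃ F N θ.toStage13Params) (wOfRecord₉ F N θ.toStage9Params) θ.ppSel p (gOfRecord₁₃ F N θ.toStage13Params p) 1 s ≠ 0 →
      FirstStepClausesAt θ p s ((σ 0 (chainWitness θ p σ 0).1 (chainWitness θ p σ 0).2).1 s) ((σ 0 (chainWitness θ p σ 0).1 (chainWitness θ p σ 0).2).2 s)

variable {θ : Stage13HParams F N} {p : B12.RunParams}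

/-- **THE FOUR LEVEL-`(k+1)` 𝐄-CLAUSES OF A FAMILY UNIVERSAL IN 𝐄 ARE HISTORY-FREE**: checked at ONE history `s₁` of length `k+1`, they hold at every history (dag-n11-e's
transfer `newEClauses_of_newEClauses_of_eqE`: the 𝐄-space reads `bgI` only, and def-T's `rzAt_bgI` is the torus residual's at every history, `rfl`).
[cite: Balaban1988Convergent, (2.25)–(2.28) p.259, §2 p.262 (bookkeeping)] -/
theorem newEClausesAt_of_universalE {k : ℕ}
    {u : SeqOfRecord F θ.ν θ.τ9.M (gOfRecord₁₃ F N θ.toStage13Params p) p.K (k + 1) → Sect2.TermValues (F.P p.K) (MatA N) (FluctV N) θ.τ9.M} (hu : Sect2.UniversalE u)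
    {s₁ : SeqOfRecord F θ.ν θ.τ9.M (gOfRecord₁₃ F N θ.toStage13Params p) p.K (k + 1)} (h : NewEClausesAt θ p k (u s₁) s₁)
    (s : SeqOfRecord F θ.ν θ.τ9.M (gOfRecord₁₃ F N θ.toStage13Params p) p.K (k + 1)) : NewEClausesAt θ p k (u s) s :=
  BalabanUVNodesN11Sect3SupplyChain.newEClauses_of_newEClauses_of_eqE (settingOfRecord₁₃ F N θ.toStage13Params p) (Rz := θ.rzAt p s₁) (Rz' := θ.rzAt p s)
    rfl s₁.Ω s.Ω (fun X z g => by rw [hu s s₁]) h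

/-- **A SUPPLIER CARRYING ITS OBLIGATIONS CARRIES THE FIRST LINK** (`0 < K`; the inductive hypothesis at `0` is `chainFormAt_zero`, (present) by §2 ★).
[cite: Balaban1988Convergent, Thm 1 p.262, §3 p.279 (bookkeeping)] -/
theorem firstLinkObligations_of_supplierObligations {σ : Sect3Supplier θ p} (hσ : SupplierObligations θ p σ) (hK : 0 < p.K) :
    FirstLinkObligations θ p σ :=
  ⟨hσ.univE 0 hK (chainFormAt_zero σ), hσ.newE 0 hK (chainFormAt_zero σ),
    fun s hΩ hT => (presentChildObligations_zero_iff _ _ _ s).mp (hσ.present 0 hK (chainFormAt_zero σ) s hΩ hT)⟩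

/-- ★ **THE FIRST LINK DELIVERS THE FIRST-STEP SUPPLY IN PRINT's INDEXING**: `FirstLinkObligations θ p σ → FirstStepSupplyAtLabels θ p` with `u, E₁ :=` the level-0 response —
at a label `t = (P₁, Q₁, R₁, S₁)` with `Ω₁(t) ≠ ∅` (`σOfRecord_zero_Ω_one`) whose transported weighted start is not identically zero (`slotsTOfRecord₁₃H_one_eq`) the labelled
child is a 𝐓-present expansion pair, so (present) applies; its zero disjunct is excluded and (iii) is the transport identity in def-T's letters (`sect2Slot = TkOfRecord ∘ sect2Operand`).
[cite: Balaban1988Convergent, §3 pp.264–270, (3.5) p.265, (3.24)–(3.25) p.270, Thm 2 p.263; Balaban1987RG1, Thm 1 p.258] -/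
theorem FirstLinkObligations.firstStepSupplyAtLabels {σ : Sect3Supplier θ p} (h : FirstLinkObligations θ p σ) : FirstStepSupplyAtLabels θ p := by
  refine ⟨(σ 0 (chainWitness θ p σ 0).1 (chainWitness θ p σ 0).2).1, (σ 0 (chainWitness θ p σ 0).1 (chainWitness θ p σ 0).2).2, h.univE, fun s₀ lab hΩ hT => ?_⟩
  have hΩ' : (σOfRecord F θ.ν θ.τ9.M p (gOfRecord₁₃ F N θ.toStage13Params p) 0 s₀ lab).Ω 1 ≠ ∅ := by
    rw [σOfRecord_zero_Ω_one]; exact hΩ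
  have hT' : slotsTOfRecord F N θ.ν θ.τ9 (EOfRecord₁₃ F N θ.toStage13Params) (wOfRecord₉ F N θ.toStage9Params) θ.ppSel p (gOfRecord₁₃ F N θ.toStage13Params p) 1
      (σOfRecord F θ.ν θ.τ9.M p (gOfRecord₁₃ F N θ.toStage13Params p) 0 s₀ lab) ≠ 0 := by
    rw [slotsTOfRecord₁₃H_one_eq θ p]; exact hT
  obtain ⟨hnew, hanE, hanR, hanB, hcl⟩ := h.present _ hΩ' hT'
  refine ⟨hnew, hanE, hanR, hanB, ?_⟩
  rw [slotsTOfRecord₁₃H_one_eq θ p, sect2Slot_eq_TkOfRecord_sect2Operand] at hcl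
  exact hcl.resolve_left hT

/-- ★ **… AND [III] §3's DELIVERABLE AT LEVEL `0`** (`0 ≤ E₀, B₀`; g0's `sect3SupplyAt_zero_of_firstStepSupplyAtLabels`).
[cite: Balaban1988Convergent, §3 p.279, (3.5) p.265, (3.25) p.270, Thm 2 p.263] -/
theorem FirstLinkObligations.sect3SupplyAt_zero {σ : Sect3Supplier θ p} (h : FirstLinkObligations θ p σ) (hE₀ : 0 ≤ θ.s2.lf.E₀) (hB₀ : 0 ≤ θ.s2.lf.B₀) :
    Sect3SupplyAt θ p 0 :=
  sect3SupplyAt_zero_of_firstStepSupplyAtLabels θ p hE₀ hB₀ h.firstStepSupplyAtLabels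

/-- **A SUPPLIER CARRYING ITS OBLIGATIONS DELIVERS THE LABELLED FIRST-STEP SUPPLY** (`0 < K`). [cite: Balaban1988Convergent, Thm 1 p.262, §3 p.279, (3.5) p.265; Balaban1987RG1, Thm 1 p.258] -/
theorem firstStepSupplyAtLabels_of_supplierObligations {σ : Sect3Supplier θ p} (hσ : SupplierObligations θ p σ) (hK : 0 < p.K) : FirstStepSupplyAtLabels θ p :=
  (firstLinkObligations_of_supplierObligations hσ hK).firstStepSupplyAtLabels

/-- ★★ **N11's ONE-TOKEN RESIDUAL CONTAINS THE FIRST STEP**: `SupplyChainAt θ p → 0 < K → FirstStepSupplyAtLabels θ p` — whoever discharges dag-n11-e's token at `(θ, p)`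
delivers on the way [I] Thm 1 + [II] at def-T's level-1 objects, in print's indexing (generic `θ`, every run with at least one step).
[cite: Balaban1988Convergent, Thm 1 p.262, Theorem p.245, §3 pp.264–270, (3.5) p.265, (3.25) p.270; Balaban1987RG1, Thm 1 p.258] -/
theorem firstStepSupplyAtLabels_of_supplyChainAt (h : SupplyChainAt θ p) (hK : 0 < p.K) : FirstStepSupplyAtLabels θ p := by
  obtain ⟨σ, hσ, -⟩ := h
  exact firstStepSupplyAtLabels_of_supplierObligations hσ hK

/-- ★★ **… AND [III] §3's DELIVERABLE AT LEVEL `0`**: `SupplyChainAt θ p → 0 < K → Sect3SupplyAt θ p 0` (`0 ≤ E₀, B₀`).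
[cite: Balaban1988Convergent, Thm 1 p.262, §3 p.279, (3.25) p.270, Thm 2 p.263] -/
theorem sect3SupplyAt_zero_of_supplyChainAt (hE₀ : 0 ≤ θ.s2.lf.E₀) (hB₀ : 0 ≤ θ.s2.lf.B₀) (h : SupplyChainAt θ p) (hK : 0 < p.K) : Sect3SupplyAt θ p 0 :=
  sect3SupplyAt_zero_of_firstStepSupplyAtLabels θ p hE₀ hB₀ (firstStepSupplyAtLabels_of_supplyChainAt h hK)

end FirstLink

/-! ## §4. The first link fed into the chain: the chain's level-1 witness from first-step data (sufficiency at the first link) -/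

section IntoChain

variable {F : T4Family} {N : ℕ} [NeZero N]
variable {θ : Stage13HParams F N} {p : B12.RunParams}

/-- ★ **THE CHAIN's LEVEL-1 WITNESS IS A 𝐓-IMAGE WITNESS AT LEVEL 0 FROM THE FIRST LINK AND THE LEVEL-0 NO-EXPANSION CLAUSE** (generic `θ`; `1 ≤ M`, `0 ≤ B₀`):
dag-n11-e's ★★ `formT_spliceTermsB_of_rows` at `k = 0` with the base witness's form (`chainFormAt_zero`), (present) converted back by §2 ★ — no obligation of any level
`k ≥ 1` is read. [cite: Balaban1988Convergent, Theorem p.245, §3 p.279, (3.24)–(3.25) p.270, (3.1) p.264, (2.25)–(2.31) pp.259–260, (2.40)–(2.42) p.261; Balaban1987RG1, Thm 1 p.258] -/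
theorem FirstLinkObligations.chainFormTAt_zero {σ : Sect3Supplier θ p} (h : FirstLinkObligations θ p σ) (hM : 1 ≤ θ.τ9.M) (hB₀ : 0 ≤ θ.s2.lf.B₀)
    (hTcl : NoExpansionClauseFor θ p 0 (chainWitness θ p σ 0).1 (chainWitness θ p σ 0).2) : ChainFormTAt θ p σ 0 :=
  formT_spliceTermsB_of_rows θ p hM hB₀ _ _ (chainFormAt_zero σ) _ _ h.univE h.newE
    (fun s hΩ h0 => (presentChildObligations_zero_iff _ _ _ s).mpr (h.present s hΩ h0)) hTcl

/-- **… HENCE `TLaw₁₃CoPH θ p 0`** (def-T's `tLaw₁₃CoPH_iff`, through dag-n11-e's `tLaw₁₃CoPH_of_chainFormTAt`). [cite: Balaban1988Convergent, remark p.262, (3.25) p.270, Theorem p.245] -/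
theorem FirstLinkObligations.tLaw₁₃CoPH_zero {σ : Sect3Supplier θ p} (h : FirstLinkObligations θ p σ) (hM : 1 ≤ θ.τ9.M) (hB₀ : 0 ≤ θ.s2.lf.B₀)
    (hTcl : NoExpansionClauseFor θ p 0 (chainWitness θ p σ 0).1 (chainWitness θ p σ 0).2) : TLaw₁₃CoPH F N θ p 0 :=
  tLaw₁₃CoPH_of_chainFormTAt (h.chainFormTAt_zero hM hB₀ hTcl)

/-- ★ **THE CHAIN's LEVEL-1 WITNESS HAS `ρ₁`'s §2 FORM ON THE LIVE-SELECTOR LINE FROM THE FIRST LINK AND THE LEVEL-0 NO-EXPANSION CLAUSE** — `ChainFormAt θ p σ 1`: the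
𝐓-step above followed by dag-n11-e's 𝐑-step ★ `formAtZS_succ_of_formT_of_liveSel_of_rstep` (core provisos — row `rstep` —, the selector clause, admissibility, `0 ≤ κ, E₀, B₀`,
`1 ≤ M`, `0 < K`).  The chain closes its first level from first-step data alone. [cite: Balaban1988Convergent, Thm 1 p.262, §2 p.262, Thm 2 p.263, (3.24)–(3.25) p.270; Balaban1989LargeFieldI, (0.2)–(0.4) p.176, p.177 (i)–(ii)] -/
theorem FirstLinkObligations.chainFormAt_one {σ : Sect3Supplier θ p} (h : FirstLinkObligations θ p σ) (hP : θ.Provisos₁₃CoPH F N)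
    (hsel : θ.ppSel = ppSelLiveOfRecord F N θ.ν θ.τ9 (EOfRecord₁₃ F N θ.toStage13Params) (wOfRecord₉ F N θ.toStage9Params))
    (hθ : θ.Admissible F N) (hκ : 0 ≤ θ.s2.lf.κ) (hE₀ : 0 ≤ θ.s2.lf.E₀) (hB₀ : 0 ≤ θ.s2.lf.B₀) (hM : 1 ≤ θ.τ9.M) (hK : 0 < p.K)
    (hTcl : NoExpansionClauseFor θ p 0 (chainWitness θ p σ 0).1 (chainWitness θ p σ 0).2) : ChainFormAt θ p σ 1 :=
  formAtZS_succ_of_formT_of_liveSel_of_rstep θ p hP hsel hθ hκ hE₀ hB₀ hK _ _ (h.chainFormTAt_zero hM hB₀ hTcl)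

/-- ★ **… HENCE `SLaw₁₃CoPH θ p 1`** — `ρ₁`'s §2 form at EVERY history of length 1, generic `θ` on the live-selector line, from the first link and the level-0 no-expansion clause.
[cite: Balaban1988Convergent, Thm 1 p.262, Theorem p.245, (3.24)–(3.25) p.270; Balaban1987RG1, Thm 1 p.258; Balaban1989LargeFieldI, (0.2)–(0.4) p.176] -/
theorem FirstLinkObligations.sLaw₁₃CoPH_one {σ : Sect3Supplier θ p} (h : FirstLinkObligations θ p σ) (hP : θ.Provisos₁₃CoPH F N)
    (hsel : θ.ppSel = ppSelLiveOfRecord F N θ.ν θ.τ9 (EOfRecord₁₃ F N θ.toStage13Params) (wOfRecord₉ F N θ.toStage9Params))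
    (hθ : θ.Admissible F N) (hκ : 0 ≤ θ.s2.lf.κ) (hE₀ : 0 ≤ θ.s2.lf.E₀) (hB₀ : 0 ≤ θ.s2.lf.B₀) (hM : 1 ≤ θ.τ9.M) (hK : 0 < p.K)
    (hTcl : NoExpansionClauseFor θ p 0 (chainWitness θ p σ 0).1 (chainWitness θ p σ 0).2) : SLaw₁₃CoPH F N θ p 1 :=
  sLaw₁₃CoPH_of_chainFormAt (h.chainFormAt_one hP hsel hθ hκ hE₀ hB₀ hM hK hTcl)

variable (θ p)

/-- **THE SUPPLIER BUILT FROM FIRST-STEP DATA**: level-`0` response `(u, E₁)` whatever the input witness; zero term values and zero constants above (a placeholder — only the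
first link of this supplier is ever asserted).  A constructor, nothing claimed. [cite: Balaban1988Convergent, §3 pp.264–265, §3 p.279 (bookkeeping)] -/
def firstStepSupplier (u : SeqOfRecord F θ.ν θ.τ9.M (gOfRecord₁₃ F N θ.toStage13Params p) p.K 1 → Sect2.TermValues (F.P p.K) (MatA N) (FluctV N) θ.τ9.M)
    (E₁ : SeqOfRecord F θ.ν θ.τ9.M (gOfRecord₁₃ F N θ.toStage13Params p) p.K 1 → ℝ) : Sect3Supplier θ p := fun k =>
  match k with
  | 0 => fun _ _ => (u, E₁)
  | _ + 1 => fun _ _ => (fun _ => Sect2.TermValues.zero, fun _ => 0)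

/-- **THE FIRST LINK OF `firstStepSupplier θ p u E₁` IS THE FIRST-STEP DATA's**: universality of `u` in 𝐄, the four level-1 𝐄-clauses for `u s` at every `s`, the first-step
clauses for `(u s, E₁ s)` at the 𝐓-present expansion pairs. [cite: Balaban1988Convergent, Thm 2 p.263, §3 p.279, (3.25) p.270, (2.25)–(2.28) p.259; Balaban1987RG1, Thm 1 p.258] -/
theorem firstLinkObligations_firstStepSupplier_iff
    (u : SeqOfRecord F θ.ν θ.τ9.M (gOfRecord₁₃ F N θ.toStage13Params p) p.K 1 → Sect2.TermValues (F.P p.K) (MatA N) (FluctV N) θ.τ9.M)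
    (E₁ : SeqOfRecord F θ.ν θ.τ9.M (gOfRecord₁₃ F N θ.toStage13Params p) p.K 1 → ℝ) :
    FirstLinkObligations θ p (firstStepSupplier θ p u E₁) ↔
      Sect2.UniversalE u ∧
      (∀ s : SeqOfRecord F θ.ν θ.τ9.M (gOfRecord₁₃ F N θ.toStage13Params p) p.K 1, NewEClausesAt θ p 0 (u s) s) ∧
      (∀ s : SeqOfRecord F θ.ν θ.τ9.M (gOfRecord₁₃ F N θ.toStage13Params p) p.K 1, s.Ω 1 ≠ ∅ →
        slotsTOfRecord F N θ.ν θ.τ9 (EOfRecord₁₃ F N θ.toStage13Params) (wOfRecord₉ F N θ.toStage9Params) θ.ppSel p (gOfRecord₁₃ F N θ.toStage13Params p) 1 s ≠ 0 →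
          FirstStepClausesAt θ p s (u s) (E₁ s)) :=
  ⟨fun h => ⟨h.univE, h.newE, h.present⟩, fun h => ⟨h.1, h.2.1, h.2.2⟩⟩

/-- ★ **`SLaw₁₃CoPH θ p 1` FROM FIRST-STEP DATA KEYED TO THE CHAIN ON THE LIVE-SELECTOR LINE** (σ-free face of ★ above; core provisos, selector clause, admissibility, signs,
`1 ≤ M`, `0 < K`): first-step term values `u` universal in 𝐄 and constants `E₁` with the four level-1 𝐄-clauses at every history and the first-step clauses at the 𝐓-present
expansion pairs, plus dag-n11-d's level-0 no-expansion clause for the base witness.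
[cite: Balaban1988Convergent, Thm 1 p.262, Theorem p.245, (3.24)–(3.25) p.270; Balaban1987RG1, Thm 1 p.258; Balaban1989LargeFieldI, (0.2)–(0.4) p.176] -/
theorem sLaw₁₃CoPH_one_of_firstStepClauses (hP : θ.Provisos₁₃CoPH F N)
    (hsel : θ.ppSel = ppSelLiveOfRecord F N θ.ν θ.τ9 (EOfRecord₁₃ F N θ.toStage13Params) (wOfRecord₉ F N θ.toStage9Params))
    (hθ : θ.Admissible F N) (hκ : 0 ≤ θ.s2.lf.κ) (hE₀ : 0 ≤ θ.s2.lf.E₀) (hB₀ : 0 ≤ θ.s2.lf.B₀) (hM : 1 ≤ θ.τ9.M) (hK : 0 < p.K)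
    (u : SeqOfRecord F θ.ν θ.τ9.M (gOfRecord₁₃ F N θ.toStage13Params p) p.K 1 → Sect2.TermValues (F.P p.K) (MatA N) (FluctV N) θ.τ9.M)
    (E₁ : SeqOfRecord F θ.ν θ.τ9.M (gOfRecord₁₃ F N θ.toStage13Params p) p.K 1 → ℝ) (hu : Sect2.UniversalE u)
    (hOE : ∀ s : SeqOfRecord F θ.ν θ.τ9.M (gOfRecord₁₃ F N θ.toStage13Params p) p.K 1, NewEClausesAt θ p 0 (u s) s)
    (hpres : ∀ s : SeqOfRecord F θ.ν θ.τ9.M (gOfRecord₁₃ F N θ.toStage13Params p) p.K 1, s.Ω 1 ≠ ∅ →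
      slotsTOfRecord F N θ.ν θ.τ9 (EOfRecord₁₃ F N θ.toStage13Params) (wOfRecord₉ F N θ.toStage9Params) θ.ppSel p (gOfRecord₁₃ F N θ.toStage13Params p) 1 s ≠ 0 →
        FirstStepClausesAt θ p s (u s) (E₁ s))
    (hTcl : NoExpansionClauseFor θ p 0 (baseWitness θ p).1 (baseWitness θ p).2) : SLaw₁₃CoPH F N θ p 1 :=
  ((firstLinkObligations_firstStepSupplier_iff θ p u E₁).mpr ⟨hu, hOE, hpres⟩).sLaw₁₃CoPH_one hP hsel hθ hκ hE₀ hB₀ hM hK hTcl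

end IntoChain

/-! ## §5. A one-step run: N11's token IS the first step plus the level-0 no-expansion clause -/

section OneStep

variable {F : T4Family} {N : ℕ} [NeZero N]
variable (θ : Stage13HParams F N) (p : B12.RunParams)

/-- ★ **FOR A ONE-STEP RUN (`K = 1`) N11's ONE-TOKEN RESIDUAL IS THE FIRST STEP**: `SupplyChainAt θ p ↔` «first-step term values `u` (1-local in the fluctuation variables,
universal in 𝐄) and constants `E₁` with the four level-1 𝐄-clauses at every history and the first-step clauses at the 𝐓-present expansion pairs» `∧` dag-n11-d's level-0
no-expansion clause for the base witness (every field above level `0` is void when `K = 1`; the base witness is the same for every supplier; `firstStepSupplier` inhabits the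
token from the data). [cite: Balaban1988Convergent, Thm 1 p.262, Theorem p.245, §3 p.279, (3.25) p.270; Balaban1987RG1, Thm 1 p.258] -/
theorem supplyChainAt_iff_of_K_eq_one (hK : p.K = 1) :
    SupplyChainAt θ p ↔
      (∃ (u : SeqOfRecord F θ.ν θ.τ9.M (gOfRecord₁₃ F N θ.toStage13Params p) p.K 1 → Sect2.TermValues (F.P p.K) (MatA N) (FluctV N) θ.τ9.M)
          (E₁ : SeqOfRecord F θ.ν θ.τ9.M (gOfRecord₁₃ F N θ.toStage13Params p) p.K 1 → ℝ),
          (∀ s : SeqOfRecord F θ.ν θ.τ9.M (gOfRecord₁₃ F N θ.toStage13Params p) p.K 1, IsFluctLocal 1 (u s)) ∧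
          Sect2.UniversalE u ∧
          (∀ s : SeqOfRecord F θ.ν θ.τ9.M (gOfRecord₁₃ F N θ.toStage13Params p) p.K 1, NewEClausesAt θ p 0 (u s) s) ∧
          (∀ s : SeqOfRecord F θ.ν θ.τ9.M (gOfRecord₁₃ F N θ.toStage13Params p) p.K 1, s.Ω 1 ≠ ∅ →
            slotsTOfRecord F N θ.ν θ.τ9 (EOfRecord₁₃ F N θ.toStage13Params) (wOfRecord₉ F N θ.toStage9Params) θ.ppSel p (gOfRecord₁₃ F N θ.toStage13Params p) 1 s ≠ 0 →
              FirstStepClausesAt θ p s (u s) (E₁ s))) ∧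
      NoExpansionClauseFor θ p 0 (baseWitness θ p).1 (baseWitness θ p).2 := by
  have hK0 : 0 < p.K := by omega
  constructor
  · rintro ⟨σ, hσ, hT⟩
    have h1 := firstLinkObligations_of_supplierObligations hσ hK0
    exact ⟨⟨_, _, fun s => hσ.loc 0 s, h1.univE, h1.newE, h1.present⟩, hT 0 hK0 (chainFormAt_zero σ)⟩
  · rintro ⟨⟨u, E₁, hloc, hu, hOE, hpres⟩, hT⟩
    have h1 : FirstLinkObligations θ p (firstStepSupplier θ p u E₁) := (firstLinkObligations_firstStepSupplier_iff θ p u E₁).mpr ⟨hu, hOE, hpres⟩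
    refine ⟨firstStepSupplier θ p u E₁, ⟨?_, ?_, ?_, ?_⟩, ?_⟩
    · intro k s
      cases k with
      | zero => exact hloc s
      | succ k => exact ⟨fun _ _ _ _ _ _ _ => rfl⟩  -- zero term values above level 0: their `𝐁` is zero
    · intro k hk _
      obtain rfl : k = 0 := by omega
      exact h1.univE
    · intro k hk _
      obtain rfl : k = 0 := by omega
      exact h1.newE
    · intro k hk _
      obtain rfl : k = 0 := by omega
      exact fun s hΩ h0 => (presentChildObligations_zero_iff _ _ _ s).mpr (h1.present s hΩ h0)
    · intro k hk _
      obtain rfl : k = 0 := by omega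
      exact hT

end OneStep

/-! ## §6. At the re-pinned door of the cured witness of record: the first link alone -/

section Door

variable (F : T4Family) (N : ℕ) [NeZero N]

/-- ★ **AT THE RE-PINNED DOOR OF K0a's CURED WITNESS OF RECORD, `ρ₁`'s §2 FORM AT EVERY HISTORY OF LENGTH 1 FROM THE FIRST LINK OF ANY SUPPLIER AND `0 < K` — NOTHING ELSE**
(g0's `sLaw₁₃CoPH_one_rePinH_doorCured_theta13LiveOfRecord_of_firstStepSupplyAtLabels` over §3 ★: there the level-0 no-expansion half, the core provisos, the selector clause,
admissibility and the signs are the door's own).  The displayed hypothesis IS the first renormalization step in the chain's currency.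
[cite: Balaban1988Convergent, Thm 1 p.262, Theorem p.245, §3 pp.264–270, (3.5) p.265, (3.24)–(3.25) p.270; Balaban1987RG1, Thm 1 p.258; Balaban1989LargeFieldI, (0.3)–(0.4) p.176] -/
theorem sLaw₁₃CoPH_one_rePinH_doorCured_theta13LiveOfRecord_of_firstLink (p : B12.RunParams) (hK : 0 < p.K)
    {σ : Sect3Supplier (rePinH (Stage13HParams.ofHistoryBlind F N (Stage13RParams.ofCured F N (theta13LiveOfRecord F N)))) p}
    (h : FirstLinkObligations (rePinH (Stage13HParams.ofHistoryBlind F N (Stage13RParams.ofCured F N (theta13LiveOfRecord F N)))) p σ) :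
    SLaw₁₃CoPH F N (rePinH (Stage13HParams.ofHistoryBlind F N (Stage13RParams.ofCured F N (theta13LiveOfRecord F N)))) p 1 :=
  sLaw₁₃CoPH_one_rePinH_doorCured_theta13LiveOfRecord_of_firstStepSupplyAtLabels F N p hK h.firstStepSupplyAtLabels

/-- ★★ **… AND FROM N11's ONE-TOKEN RESIDUAL AT THAT DOOR**: `SupplyChainAt θᵈ p → 0 < K → SLaw₁₃CoPH θᵈ p 1`, `θᵈ` the re-pinned door of the cured witness of record.
[cite: Balaban1988Convergent, Thm 1 p.262, Theorem p.245, §3 p.279, (3.25) p.270; Balaban1987RG1, Thm 1 p.258; Balaban1989LargeFieldI, (0.3)–(0.4) p.176] -/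
theorem sLaw₁₃CoPH_one_rePinH_doorCured_theta13LiveOfRecord_of_supplyChainAt (p : B12.RunParams) (hK : 0 < p.K)
    (h : SupplyChainAt (rePinH (Stage13HParams.ofHistoryBlind F N (Stage13RParams.ofCured F N (theta13LiveOfRecord F N)))) p) :
    SLaw₁₃CoPH F N (rePinH (Stage13HParams.ofHistoryBlind F N (Stage13RParams.ofCured F N (theta13LiveOfRecord F N)))) p 1 :=
  sLaw₁₃CoPH_one_rePinH_doorCured_theta13LiveOfRecord_of_firstStepSupplyAtLabels F N p hK (firstStepSupplyAtLabels_of_supplyChainAt h hK)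

end Door

end Summit.QuantumFields.YangMills.Theorems.BalabanUVNodesN11SupplyChainFirstLink

end
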